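import Summits.QuantumFields.BalabanUV.Beta.FP.GhostLoopCountingGramWords
import Summits.QuantumFields.BalabanUV.Beta.FP.MixLoopPowerCountingMassQuartic

/-!
# `BalabanUV.Beta.FP.GhostLoopCountingGram` — road «FP» for binder row D1, organisation γ, row **(GH-a) COUNTING** (owner ruling R-FP-28 (d),
# piece list N-d1leaf05g12-1 adopted), piece **(g5)** «THE GRAM LOOPS» `½·secondVar(𝓘ᵀ𝓘; Ṁ, M̈)`, PART 2 of 2: the polarised Gram loop kernel
# `k₅(b,b′) = ½tr(M⁻¹M̈_{bb′}) − ½tr(M⁻¹Ṁ_bM⁻¹Ṁ_{b′})` is ALL-MASSIVE (`|k₅(b,b′)| ≤ C₅·e^{−(min(δ,δ_M)∕(2n))‖b′−b‖∞}`), its (Mκ₅) letter, and its J-contraction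
# BY NAME (`FP/MixLoopPowerCountingMassQuartic.coarse_secondMoment_of_majorant`)
# ([folklore] lattice bookkeeping on `ℤ⁴`; abstract kernels over FINITE windows; every letter a displayed hypothesis; NO road object; PART 1 = `FP/GhostLoopCountingGramWords`)

HONEST DEPENDENCY (page 1, mandatory): continuum YM on T⁴ ⇐ BetaPertH ∧ nine spine estimates (0/9 proved); BetaPertH ⇐ (D1) ∧ (D4) ∧
CAP+tail; G-an2-4 gates asym, D1 and NE2/3/4.  HONEST FRAMING (cell contract, verbatim): «discharging `BetaPertH` makes Bałaban's UV
stability UNCONDITIONAL — a real constructive-QFT result; it is NOT the continuum limit and NOT the Clay problem.»  THIS MODULE is elementary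
[folklore] real analysis on `ℤ⁴` composed BY NAME from PART 1 (`majorantLetter_massive`, `abs_trace₂_le`, `abs_trace₄_le`) and the J-contraction lemma of
`FP/MixLoopPowerCountingMassQuartic`.  It asserts nothing about Bałaban's objects, cites nothing, mints no `Prop` fact, has no `def`, 0 sorry.  NOT (GH-a) ((g1)
`FP/GhostLoopCountingWindow`, (g2)(g3) `FP/GhostLoopCountingFar`, (g4) NOT here), NOT the (I-gh) letter, NOT `hbook`, NOT D1, NOT BetaPertH, NOT continuum, NOT Clay.

ABSOLUTE RULE (cell charter, verbatim): «No internally-minted statement may enter as a cited fact. Every hypothesis is either kernel-proved in this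
package or a verbatim quotation of a PUBLISHED theorem with page reference. The manuscript(s) under audit are NOT citable for their own disputed
steps — they are the thing under adjudication; programme-internal (2001/route/tribunal) claims are never citable.»

ROW ∕ PROVENANCE ∕ BINDING CHECK ∕ LETTERS (Minv)(KM)(D)(D₂)(KV): as displayed in PART 1 `FP/GhostLoopCountingGramWords` (the Gram addend of the KKT form of record
`FP/GhostGramJets.hasDerivAt_ghostFirstVar`, words `Ṁ = İᵀ𝓘 + 𝓘ᵀİ`, `M̈ = Ïᵀ𝓘 + 2İᵀİ + 𝓘ᵀÏ` of `FP/GhostGramJets{,Second}` ✓, polarised in the two background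
insertions; «legs `(𝓘ᵀ𝓘)⁻¹` massive, WCI ✓» ⟹ ALL-MASSIVE on scale `n`, no window, R-γ-15 cannot arise).  The kernel enters ONLY through the displayed hypothesis
`k b b′ = ½·(Σ_{v,v′∈V} Minv v′ v·D₂ b b′ v v′) − ½·(Σ_{v₁…v₄∈V} Minv v₁ v₂·D b v₂ v₃·Minv v₃ v₄·D b′ v₄ v₁)`; nothing of the tree's identities is used or restated.
CONTENT ([folklore]; `Θ := 1 + 480·e^{δ∕4}·(4∕δ)⁴`, `c₃(a) := 1 + 480·e^{a∕2}·(2∕a)⁴`, `c₅(a) := 1 + 9600·e^{a∕2}·(2∕a)⁶`, `a := min(δ,δ_M)∕2`,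
`C₅ := ½(C_M·C_D₂·K_V² + C_M²·C_D²·K_M²·K_V²)`):
* **`abs_gramKernel_le`** — `|k₅ b b′| ≤ C₅·e^{−(a∕n)‖b′−b‖∞}` for ALL `b, b′`;
* **`majorantLetter_gram`** — (Mκ₅): `Σ_{b∈S}Σ_{b′∈S} e^{−(δ∕(2n))‖b−n•v₀‖∞}·(1 + (‖b′−b‖∞∕n)²)·|k₅ b b′| ≤ Θ·n⁴·(C₅·(c₃(a) + c₅(a))·n⁴)` (powers displayed `n⁴·n⁴`);
* **`secondMoment_gram`** — the J-contraction BY NAME: `Σ_{v∈W}‖v−v₀‖∞²·|Σ_{b,b′∈S} J b v₀·J b′ v·k₅ b b′| ≤ 3·C_J·C_J′·(1 + 16∕δ²)·A_κ₅`.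
INSTANCE SIZES (owner GO l.26333 «keep them abstract exactly as you do»): `C_M, δ_M` = WCI constants of `(𝓘ᵀ𝓘)⁻¹`; `C_D ≍ (column sup of 𝓘)·(column sup of İ_b)`-type
and `C_D₂ ≍ (column sup of İ)² + (column sup of 𝓘)·(column sup of Ï)`-type (quadratic in the (I-gh) column letters); NO commitment to κ = 4 ∕ 5 — the powers of `n` of
`C_D, C_D₂, C_J, C_J′` are pinned by KER-γ (β) (R-FP-31) in row RHOA-6e's ledger, not here.  Provenance: D1 formalisation swarm, unit
`b2b-balaban-beta-d1-formalise-leaf-05` gen 13 (prover-b2b-balaban-beta-d1-formalise-leaf-05-g13-0), 2026-08-21, first-refusal holder of (GH-a) COUNTING by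
R-FP-28 (d); «not in print; our bookkeeping»; no existing file touched.
-/

noncomputable section

namespace Summit.QuantumFields.BalabanUV.Beta.FP.GhostLoopCountingGram

open Finset Real
open scoped BigOperators
open Literature.MathematicalPhysics.QuantumFieldTheory.Balaban1983to89.Beta.DyadicShell (Pt supNorm)
open Summit.QuantumFields.BalabanUV.Beta.FP.MixLoopPowerCounting (supNorm_cast_nonneg)
open Summit.QuantumFields.BalabanUV.Beta.FP.GhostLoopCountingGramWords (majorantLetter_massive abs_trace₂_le abs_trace₄_le)
open Summit.QuantumFields.BalabanUV.Beta.FP.MixLoopPowerCountingMassQuartic (coarse_secondMoment_of_majorant)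


/-! ## §3 The Gram loop kernel: pointwise shape, (Mκ₅), and the J-contraction -/

section Gram

variable {k : Pt → Pt → ℝ} {V : Finset Pt} {Minv : Pt → Pt → ℝ} {D : Pt → Pt → Pt → ℝ} {D₂ : Pt → Pt → Pt → Pt → ℝ}
  {J : Pt → Pt → ℝ} {C_M C_D C_D₂ K_V K_M C_J C_J' δ δ_M : ℝ} {n : ℕ}

/-- [folklore] **THE GRAM LOOP KERNEL IS ALL-MASSIVE**: if `k b b′ = ½·(Σ_{v,v′∈V} Minv v′ v·D₂ b b′ v v′) − ½·(Σ_{v₁…v₄∈V} Minv v₁ v₂·D b v₂ v₃·Minv v₃ v₄·D b′ v₄ v₁)`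
(the polarised `½·secondVar(M; Ṁ, M̈) = ½tr(M⁻¹M̈) − ½tr(M⁻¹ṀM⁻¹Ṁ)` at the insertions `b, b′`), then under (Minv)(KM)(D)(D₂)(KV)
`|k b b′| ≤ ½·(C_M·C_D₂·K_V² + C_M²·C_D²·K_M²·K_V²)·e^{−(min(δ,δ_M)∕(2n))‖b′−b‖∞}` for ALL `b, b′`. -/
theorem abs_gramKernel_le (hδ : 0 < δ) (hδM : 0 < δ_M) (hn : 1 ≤ n)
    (hM : ∀ v v', |Minv v v'| ≤ C_M * Real.exp (-δ_M * (supNorm (v - v') : ℝ)))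
    (hKM : ∀ v, ∑ v' ∈ V, Real.exp (-(δ_M / 2) * (supNorm (v - v') : ℝ)) ≤ K_M)
    (hD : ∀ b v v', |D b v v'| ≤ C_D * Real.exp (-(δ / n) * (supNorm (b - (n : ℤ) • v) : ℝ)) *
        Real.exp (-(δ / n) * (supNorm (b - (n : ℤ) • v') : ℝ)))
    (hD₂ : ∀ b b' v v', |D₂ b b' v v'| ≤ C_D₂ * Real.exp (-(δ / n) * (supNorm (b' - b) : ℝ)) *
        Real.exp (-(δ / n) * (supNorm (b - (n : ℤ) • v) : ℝ)) * Real.exp (-(δ / n) * (supNorm (b' - (n : ℤ) • v') : ℝ)))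
    (hKV : ∀ b, ∑ v ∈ V, Real.exp (-(δ / (2 * n)) * (supNorm (b - (n : ℤ) • v) : ℝ)) ≤ K_V)
    (hk : ∀ b b', k b b' = (1 / 2 : ℝ) * (∑ v ∈ V, ∑ v' ∈ V, Minv v' v * D₂ b b' v v')
      - (1 / 2 : ℝ) * (∑ v₁ ∈ V, ∑ v₂ ∈ V, ∑ v₃ ∈ V, ∑ v₄ ∈ V, Minv v₁ v₂ * D b v₂ v₃ * Minv v₃ v₄ * D b' v₄ v₁)) (b b' : Pt) :
    |k b b'| ≤ (1 / 2 : ℝ) * (C_M * C_D₂ * K_V ^ 2 + C_M ^ 2 * C_D ^ 2 * K_M ^ 2 * K_V ^ 2)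
        * Real.exp (-(min δ δ_M / (2 * n)) * (supNorm (b' - b) : ℝ)) := by
  have hn' : (0 : ℝ) < n := by exact_mod_cast hn
  have h₂ := abs_trace₂_le (V := V) hδ hδM hn hM hD₂ hKV b b'
  have h₄ := abs_trace₄_le (V := V) hδ hδM hn hM hKM hD hKV b b'
  -- the full-rate exponential of the first word is under the chain rate
  have hs0 : 0 ≤ (supNorm (b' - b) : ℝ) := supNorm_cast_nonneg _
  have hex : Real.exp (-(δ / n) * (supNorm (b' - b) : ℝ)) ≤ Real.exp (-(min δ δ_M / (2 * n)) * (supNorm (b' - b) : ℝ)) := by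
    apply Real.exp_le_exp.mpr
    have h1 : min δ δ_M / (2 * n) ≤ δ / n := by
      rw [div_le_div_iff₀ (by positivity) hn']
      nlinarith [min_le_left δ δ_M, lt_min hδ hδM]
    nlinarith
  have hpre₂ : 0 ≤ C_M * C_D₂ * K_V ^ 2 := by
    have := (abs_nonneg _).trans h₂
    exact nonneg_of_mul_nonneg_left this (Real.exp_pos _)
  rw [hk b b', ← mul_sub]
  rw [abs_mul, abs_of_pos (by norm_num : (0 : ℝ) < 1 / 2)]
  refine (mul_le_mul_of_nonneg_left (abs_sub _ _) (by norm_num)).trans ?_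
  rw [mul_assoc]
  refine mul_le_mul_of_nonneg_left ?_ (by norm_num)
  rw [add_mul]
  exact add_le_add (h₂.trans (mul_le_mul_of_nonneg_left hex hpre₂)) h₄

/-- [folklore] **(Mκ₅) — THE GRAM LOOPS IN (Mκ) CURRENCY**: under the hypotheses of `abs_gramKernel_le`, for every finite fine window `S` and coarse reference row `v₀`,
`Σ_{b∈S} Σ_{b′∈S} e^{−(δ∕(2n))‖b−n•v₀‖∞}·(1 + (‖b′−b‖∞∕n)²)·|k b b′| ≤ Θ·n⁴·(C₅·(c₃(a) + c₅(a))·n⁴)` with `C₅ = ½(C_M C_D₂ K_V² + C_M² C_D² K_M² K_V²)`,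
`a = min(δ,δ_M)∕2`, `Θ = 1 + 480e^{δ∕4}(4∕δ)⁴`, `c₃(a) = 1 + 480e^{a∕2}(2∕a)⁴`, `c₅(a) = 1 + 9600e^{a∕2}(2∕a)⁶` — `majorantLetter_massive` at the shape of `abs_gramKernel_le`. -/
theorem majorantLetter_gram (hδ : 0 < δ) (hδM : 0 < δ_M) (hn : 1 ≤ n) (S : Finset Pt) (v₀ : Pt)
    (hM : ∀ v v', |Minv v v'| ≤ C_M * Real.exp (-δ_M * (supNorm (v - v') : ℝ)))
    (hKM : ∀ v, ∑ v' ∈ V, Real.exp (-(δ_M / 2) * (supNorm (v - v') : ℝ)) ≤ K_M)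
    (hD : ∀ b v v', |D b v v'| ≤ C_D * Real.exp (-(δ / n) * (supNorm (b - (n : ℤ) • v) : ℝ)) *
        Real.exp (-(δ / n) * (supNorm (b - (n : ℤ) • v') : ℝ)))
    (hD₂ : ∀ b b' v v', |D₂ b b' v v'| ≤ C_D₂ * Real.exp (-(δ / n) * (supNorm (b' - b) : ℝ)) *
        Real.exp (-(δ / n) * (supNorm (b - (n : ℤ) • v) : ℝ)) * Real.exp (-(δ / n) * (supNorm (b' - (n : ℤ) • v') : ℝ)))
    (hKV : ∀ b, ∑ v ∈ V, Real.exp (-(δ / (2 * n)) * (supNorm (b - (n : ℤ) • v) : ℝ)) ≤ K_V)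
    (hk : ∀ b b', k b b' = (1 / 2 : ℝ) * (∑ v ∈ V, ∑ v' ∈ V, Minv v' v * D₂ b b' v v')
      - (1 / 2 : ℝ) * (∑ v₁ ∈ V, ∑ v₂ ∈ V, ∑ v₃ ∈ V, ∑ v₄ ∈ V, Minv v₁ v₂ * D b v₂ v₃ * Minv v₃ v₄ * D b' v₄ v₁)) :
    ∑ b ∈ S, ∑ b' ∈ S, Real.exp (-(δ / (2 * n)) * (supNorm (b - (n : ℤ) • v₀) : ℝ)) *
        (1 + ((supNorm (b' - b) : ℝ) / n) ^ 2) * |k b b'|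
      ≤ (1 + 480 * Real.exp (δ / 4) * (4 / δ) ^ 4) * (n : ℝ) ^ 4 *
          (((1 / 2 : ℝ) * (C_M * C_D₂ * K_V ^ 2 + C_M ^ 2 * C_D ^ 2 * K_M ^ 2 * K_V ^ 2))
            * ((1 + 480 * Real.exp ((min δ δ_M / 2) / 2) * (2 / (min δ δ_M / 2)) ^ 4)
              + (1 + 9600 * Real.exp ((min δ δ_M / 2) / 2) * (2 / (min δ δ_M / 2)) ^ 6)) * (n : ℝ) ^ 4) := by
  have hpt := abs_gramKernel_le (k := k) (V := V) hδ hδM hn hM hKM hD hD₂ hKV hk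
  have hC : 0 ≤ (1 / 2 : ℝ) * (C_M * C_D₂ * K_V ^ 2 + C_M ^ 2 * C_D ^ 2 * K_M ^ 2 * K_V ^ 2) := by
    have h := (abs_nonneg _).trans (hpt v₀ v₀)
    exact nonneg_of_mul_nonneg_left h (Real.exp_pos _)
  have ha : 0 < min δ δ_M / 2 := by have := lt_min hδ hδM; positivity
  refine majorantLetter_massive hδ hC ha hn S v₀ fun b b' => (hpt b b').trans (le_of_eq ?_)
  congr 2
  field_simp

/-- [folklore] **(g5) J-CONTRACTED — THE COARSE SECOND MOMENT OF THE GRAM LOOPS**, `MixLoopPowerCountingMassQuartic.coarse_secondMoment_of_majorant` BY NAME at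
`κ := |k|`: under the hypotheses of `majorantLetter_gram` and the J letters (J), (J′),
`Σ_{v∈W} ‖v−v₀‖∞²·|Σ_{b,b′∈S} J b v₀·J b′ v·k b b′| ≤ 3·C_J·C_J′·(1 + 16∕δ²)·A_κ₅` with `A_κ₅` the constant of `majorantLetter_gram` (powers displayed `n⁴·n⁴`). -/
theorem secondMoment_gram (hδ : 0 < δ) (hδM : 0 < δ_M) (hn : 1 ≤ n) (S W : Finset Pt) (v₀ : Pt)
    (hM : ∀ v v', |Minv v v'| ≤ C_M * Real.exp (-δ_M * (supNorm (v - v') : ℝ)))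
    (hKM : ∀ v, ∑ v' ∈ V, Real.exp (-(δ_M / 2) * (supNorm (v - v') : ℝ)) ≤ K_M)
    (hD : ∀ b v v', |D b v v'| ≤ C_D * Real.exp (-(δ / n) * (supNorm (b - (n : ℤ) • v) : ℝ)) *
        Real.exp (-(δ / n) * (supNorm (b - (n : ℤ) • v') : ℝ)))
    (hD₂ : ∀ b b' v v', |D₂ b b' v v'| ≤ C_D₂ * Real.exp (-(δ / n) * (supNorm (b' - b) : ℝ)) *
        Real.exp (-(δ / n) * (supNorm (b - (n : ℤ) • v) : ℝ)) * Real.exp (-(δ / n) * (supNorm (b' - (n : ℤ) • v') : ℝ)))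
    (hKV : ∀ b, ∑ v ∈ V, Real.exp (-(δ / (2 * n)) * (supNorm (b - (n : ℤ) • v) : ℝ)) ≤ K_V)
    (hk : ∀ b b', k b b' = (1 / 2 : ℝ) * (∑ v ∈ V, ∑ v' ∈ V, Minv v' v * D₂ b b' v v')
      - (1 / 2 : ℝ) * (∑ v₁ ∈ V, ∑ v₂ ∈ V, ∑ v₃ ∈ V, ∑ v₄ ∈ V, Minv v₁ v₂ * D b v₂ v₃ * Minv v₃ v₄ * D b' v₄ v₁))
    (hJ : ∀ b, |J b v₀| ≤ C_J * Real.exp (-(δ / n) * (supNorm (b - (n : ℤ) • v₀) : ℝ)))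
    (hJ' : ∀ b', ∑ v ∈ W, (1 + ((supNorm (b' - (n : ℤ) • v) : ℝ) / n) ^ 2) * |J b' v| ≤ C_J') :
    ∑ v ∈ W, (supNorm (v - v₀) : ℝ) ^ 2 * |∑ b ∈ S, ∑ b' ∈ S, J b v₀ * J b' v * k b b'|
      ≤ 3 * C_J * C_J' * (1 + 16 / δ ^ 2) *
          ((1 + 480 * Real.exp (δ / 4) * (4 / δ) ^ 4) * (n : ℝ) ^ 4 *
            (((1 / 2 : ℝ) * (C_M * C_D₂ * K_V ^ 2 + C_M ^ 2 * C_D ^ 2 * K_M ^ 2 * K_V ^ 2))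
              * ((1 + 480 * Real.exp ((min δ δ_M / 2) / 2) * (2 / (min δ δ_M / 2)) ^ 4)
                + (1 + 9600 * Real.exp ((min δ δ_M / 2) / 2) * (2 / (min δ δ_M / 2)) ^ 6)) * (n : ℝ) ^ 4)) :=
  coarse_secondMoment_of_majorant (κ := fun b b' => |k b b'|) hδ hn S W v₀ (fun _ _ => le_rfl) hJ hJ'
    (majorantLetter_gram hδ hδM hn S v₀ hM hKM hD hD₂ hKV hk)

end Gram

end Summit.QuantumFields.BalabanUV.Beta.FP.GhostLoopCountingGram

end
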